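import Mathlib.Analysis.Calculus.DerivativeTest
import Mathlib.Analysis.Calculus.Deriv.Inv
import Mathlib.Analysis.Calculus.Deriv.Pow
import Mathlib.Analysis.Calculus.Deriv.Mul
import Mathlib.Analysis.Calculus.LocalExtr.Basic
import Mathlib.Analysis.InnerProductSpace.PiL2
import HarnessLib
import Literature.MathematicalPhysics.StatisticalMechanics.LennardJonesClusters

/-!
# ContactSaturationLadder · `LooseTextureRung` (stmt-AtomisticToContinuum-30303) — the TRACE CONTACT RADIUS of a
Lennard-Jones ground state

Helper module (DEF-FREE) for the crux
`Summit.AtomisticToContinuum.Crystallization.Theses.ContactSaturationLadder.LooseTextureRung`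
(decomp-a2c lens-1 g29, critic row 370 §39(c): the support statement `TraceContactGS` of the node section
`ParticipationFence39`, used by `surplusSurfaceLaw_of_lpl` to place every finite Lennard-Jones ground state in the
texture class `𝒯(7/10, 8/7)` of the `LocalParticipationLaw`).

## What is proved

* `exists_dist_le_of_isGroundState` — **TRACE CONTACT.** In a finite Lennard-Jones ground state `x : Fin N → ℝ³` with at
  least two particles, EVERY particle has another particle within distance `8/7`:
  `IsGroundState V_LJ x → j ≠ i → ∃ k ≠ i, dist (x i) (x k) ≤ 8/7`.

  Proof (the trace / Laplacian test, folklore): if all `r_ik > 8/7` then for `|s| < 1` the configurations obtained by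
  displacing particle `i` by `± s` along each coordinate axis consist of distinct points, so by minimality the function
  `H(s) = Σ_{m<3} Σ_{k≠i} V_LJ(|x_i + s e_m − x_k|)` has a local minimum at `s = 0`.  With `V_LJ(r) = W(r²)`,
  `W(ρ) = ρ⁻⁶/12 − ρ⁻³/6`, and `|x_i + s e_m − x_k|² = A_k + 2 B_{km} s + s²` (`A_k = r_ik²`, `Σ_m B_{km}² = A_k`),
  `H` is smooth near `0` with `H''(0) = Σ_k (4 A_k W''(A_k) + 6 W'(A_k)) = Σ_k (11 A_k⁻⁷ − 5 A_k⁻⁴)` — the trace of the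
  Hessian of the site energy, i.e. `Σ_k Δ(V_LJ∘|·|)(x_i − x_k) = Σ_k (11 r⁻¹⁴ − 5 r⁻⁸)` — which is `< 0` as soon as every
  `r_ik⁶ > 11/5` (`(8/7)⁶ = 262144/117649 > 11/5`).  Mathlib's second-derivative test then makes `0` a local MAXIMUM
  too, so `H` is locally constant, so `H'' (0) = 0` — contradiction.
* `not_isLocalMin_traceSum` — the configuration-free calculus core (any finite family of `A_k > 64/49` with
  `Σ_m B_{km}² = A_k`).
* `siteEnergy_le_of_isGroundState` — the RELOCATION inequality `𝓔ⁱ(x) ≤ Σ_{k≠i} V_LJ(|z − x_k|)` for every point `z`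
  avoiding the other particles (the pattern of `siteEnergy_nonpos_of_isGroundState`).

No `sorry`, no new axioms, no definitions.  The constant `8/7` is any convenient rational above `(11/5)^{1/6} ≈ 1.1404`.
-/

namespace Summit.AtomisticToContinuum.Crystallization.Theorems.ContactSaturationLadderTraceContact

open scoped BigOperators
open Filter Topology
open Literature.MathematicalPhysics.StatisticalMechanics (lennardJones IsGroundState siteEnergy interactionEnergy
  groundStateEnergy_lennardJones_le sum_siteEnergy_update_sub two_mul_interactionEnergy)

/-! ## §1 One-variable calculus of `W(ρ) = ρ⁻⁶/12 − ρ⁻³/6` -/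

/-- `V_LJ(r) = W(r²)` (private: the same `ring` identity is `OnePercentFccRung.lennardJones_eq_sq` in a heavy, not co-importable module). [folklore] -/
private theorem lennardJones_eq_sq (r : ℝ) :
    lennardJones r = 1 / 12 * ((r ^ 2)⁻¹) ^ 6 - 1 / 6 * ((r ^ 2)⁻¹) ^ 3 := by
  unfold lennardJones
  ring

/-- `W' (ρ) = −ρ⁻⁷/2 + ρ⁻⁴/2`. [folklore] -/
theorem hasDerivAt_W {ρ : ℝ} (hρ : ρ ≠ 0) :
    HasDerivAt (fun t : ℝ => 1 / 12 * (t⁻¹) ^ 6 - 1 / 6 * (t⁻¹) ^ 3)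
      (-(1 / 2) * (ρ⁻¹) ^ 7 + 1 / 2 * (ρ⁻¹) ^ 4) ρ := by
  have h := hasDerivAt_inv hρ
  have h6 : HasDerivAt (fun t : ℝ => (t⁻¹) ^ 6) (((6 : ℕ) : ℝ) * (ρ⁻¹) ^ (6 - 1) * (-(ρ ^ 2)⁻¹)) ρ := h.pow 6
  have h3 : HasDerivAt (fun t : ℝ => (t⁻¹) ^ 3) (((3 : ℕ) : ℝ) * (ρ⁻¹) ^ (3 - 1) * (-(ρ ^ 2)⁻¹)) ρ := h.pow 3
  have h' : HasDerivAt (fun t : ℝ => 1 / 12 * (t⁻¹) ^ 6 - 1 / 6 * (t⁻¹) ^ 3)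
      (1 / 12 * (((6 : ℕ) : ℝ) * (ρ⁻¹) ^ (6 - 1) * (-(ρ ^ 2)⁻¹))
        - 1 / 6 * (((3 : ℕ) : ℝ) * (ρ⁻¹) ^ (3 - 1) * (-(ρ ^ 2)⁻¹))) ρ :=
    (h6.const_mul (1 / 12 : ℝ)).sub (h3.const_mul (1 / 6 : ℝ))
  refine h'.congr_deriv ?_
  simp only [Nat.cast_ofNat, show (6 - 1 : ℕ) = 5 from rfl, show (3 - 1 : ℕ) = 2 from rfl]
  field_simp
  ring

/-- `W''(ρ) = 7ρ⁻⁸/2 − 2ρ⁻⁵`. [folklore] -/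
theorem hasDerivAt_W1 {ρ : ℝ} (hρ : ρ ≠ 0) :
    HasDerivAt (fun t : ℝ => -(1 / 2) * (t⁻¹) ^ 7 + 1 / 2 * (t⁻¹) ^ 4)
      (7 / 2 * (ρ⁻¹) ^ 8 - 2 * (ρ⁻¹) ^ 5) ρ := by
  have h := hasDerivAt_inv hρ
  have h7 : HasDerivAt (fun t : ℝ => (t⁻¹) ^ 7) (((7 : ℕ) : ℝ) * (ρ⁻¹) ^ (7 - 1) * (-(ρ ^ 2)⁻¹)) ρ := h.pow 7
  have h4 : HasDerivAt (fun t : ℝ => (t⁻¹) ^ 4) (((4 : ℕ) : ℝ) * (ρ⁻¹) ^ (4 - 1) * (-(ρ ^ 2)⁻¹)) ρ := h.pow 4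
  have h' : HasDerivAt (fun t : ℝ => -(1 / 2) * (t⁻¹) ^ 7 + 1 / 2 * (t⁻¹) ^ 4)
      (-(1 / 2) * (((7 : ℕ) : ℝ) * (ρ⁻¹) ^ (7 - 1) * (-(ρ ^ 2)⁻¹))
        + 1 / 2 * (((4 : ℕ) : ℝ) * (ρ⁻¹) ^ (4 - 1) * (-(ρ ^ 2)⁻¹))) ρ :=
    (h7.const_mul (-(1 / 2) : ℝ)).add (h4.const_mul (1 / 2 : ℝ))
  refine h'.congr_deriv ?_
  simp only [Nat.cast_ofNat, show (7 - 1 : ℕ) = 6 from rfl, show (4 - 1 : ℕ) = 3 from rfl]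
  field_simp
  ring

/-- The squared distance along a coordinate displacement is the quadratic `a + 2bs + s²`. [folklore] -/
theorem hasDerivAt_quad (a b s : ℝ) :
    HasDerivAt (fun t : ℝ => a + 2 * b * t + t ^ 2) (2 * b + 2 * s) s := by
  have h1 : HasDerivAt (fun t : ℝ => a + 2 * b * t) (0 + 2 * b * 1) s :=
    (hasDerivAt_const s a).add ((hasDerivAt_id s).const_mul (2 * b))
  have h2 : HasDerivAt (fun t : ℝ => t ^ 2) (((2 : ℕ) : ℝ) * s ^ (2 - 1) * 1) s := (hasDerivAt_id s).pow 2
  have h : HasDerivAt (fun t : ℝ => a + 2 * b * t + t ^ 2) (0 + 2 * b * 1 + ((2 : ℕ) : ℝ) * s ^ (2 - 1) * 1) s :=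
    h1.add h2
  refine h.congr_deriv ?_
  simp only [Nat.cast_ofNat, show (2 - 1 : ℕ) = 1 from rfl, pow_one, mul_one, zero_add]

/-- `d/dt (2b + 2t) = 2`. -/
theorem hasDerivAt_lin (b s : ℝ) : HasDerivAt (fun t : ℝ => 2 * b + 2 * t) 2 s := by
  have h : HasDerivAt (fun t : ℝ => 2 * b + 2 * t) (0 + 2 * 1) s :=
    (hasDerivAt_const s (2 * b)).add ((hasDerivAt_id s).const_mul 2)
  refine h.congr_deriv ?_
  norm_num

/-- First derivative of `s ↦ W(a + 2bs + s²)`. [folklore] -/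
theorem hasDerivAt_Wq {a b s : ℝ} (h : a + 2 * b * s + s ^ 2 ≠ 0) :
    HasDerivAt (fun t : ℝ => 1 / 12 * ((a + 2 * b * t + t ^ 2)⁻¹) ^ 6 - 1 / 6 * ((a + 2 * b * t + t ^ 2)⁻¹) ^ 3)
      ((-(1 / 2) * ((a + 2 * b * s + s ^ 2)⁻¹) ^ 7 + 1 / 2 * ((a + 2 * b * s + s ^ 2)⁻¹) ^ 4)
        * (2 * b + 2 * s)) s := by
  have hW := hasDerivAt_W h
  exact hW.comp s (hasDerivAt_quad a b s)

/-- Second derivative of `s ↦ W(a + 2bs + s²)` (derivative of the first). [folklore] -/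
theorem hasDerivAt_Wq1 {a b s : ℝ} (h : a + 2 * b * s + s ^ 2 ≠ 0) :
    HasDerivAt (fun t : ℝ => (-(1 / 2) * ((a + 2 * b * t + t ^ 2)⁻¹) ^ 7
        + 1 / 2 * ((a + 2 * b * t + t ^ 2)⁻¹) ^ 4) * (2 * b + 2 * t))
      ((7 / 2 * ((a + 2 * b * s + s ^ 2)⁻¹) ^ 8 - 2 * ((a + 2 * b * s + s ^ 2)⁻¹) ^ 5) * (2 * b + 2 * s)
          * (2 * b + 2 * s)
        + (-(1 / 2) * ((a + 2 * b * s + s ^ 2)⁻¹) ^ 7 + 1 / 2 * ((a + 2 * b * s + s ^ 2)⁻¹) ^ 4) * 2) s := by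
  have hW := hasDerivAt_W1 h
  have hc := hW.comp s (hasDerivAt_quad a b s)
  exact hc.mul (hasDerivAt_lin b s)

/-- The quadratic `A + 2Bs + s²` with `B² ≤ A`, `A > 64/49` does not vanish for `|s| < 1`. [folklore] -/
theorem quad_ne_zero {A B s : ℝ} (hA : 64 / 49 < A) (hB : B ^ 2 ≤ A) (hs : |s| < 1) :
    A + 2 * B * s + s ^ 2 ≠ 0 := by
  intro h0
  have e1 : (B + s) ^ 2 = B ^ 2 - A := by linear_combination h0
  have e2 : (B + s) ^ 2 = 0 := le_antisymm (by rw [e1]; linarith) (sq_nonneg _)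
  have e3 : B + s = 0 := (pow_eq_zero_iff two_ne_zero).1 e2
  have e4 : B = -s := by linarith
  rw [e4] at e1
  have hs' := abs_lt.1 hs
  nlinarith [hs'.1, hs'.2]

/-- The per-particle trace `4 A W''(A) + 6 W'(A) = 11 A⁻⁷ − 5 A⁻⁴` is negative for `A > 64/49`
(`A³ ≥ (64/49)³ = 262144/117649 > 11/5`). [folklore] -/
theorem trace_neg {A : ℝ} (hA : 64 / 49 < A) : 11 * (A⁻¹) ^ 7 - 5 * (A⁻¹) ^ 4 < 0 := by
  have hA0 : 0 < A := by linarith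
  have hinv : A⁻¹ < 49 / 64 := by
    rw [inv_eq_one_div, div_lt_iff₀ hA0]
    linarith
  have h3 : (A⁻¹) ^ 3 < (49 / 64 : ℝ) ^ 3 := pow_lt_pow_left₀ hinv (inv_nonneg.2 hA0.le) (by norm_num)
  have h4 : 0 < (A⁻¹) ^ 4 := pow_pos (inv_pos.2 hA0) 4
  have h5 : 0 < 5 - 11 * (A⁻¹) ^ 3 := by
    have h3' : (A⁻¹) ^ 3 < 5 / 11 := lt_trans h3 (by norm_num)
    linarith
  nlinarith [mul_pos h4 h5]

/-- **Calculus core.** For a non-empty finite family of `A_k > 64/49` and `B_{km}` with `Σ_m B_{km}² = A_k`, the function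
`H(s) = Σ_k Σ_{m<3} W(A_k + 2B_{km}s + s²)` has NO local minimum at `0`: it is smooth near `0` with
`H''(0) = Σ_k (11A_k⁻⁷ − 5A_k⁻⁴) < 0`, so a local minimum would also be a local maximum (second-derivative test), making
`H` locally constant and `H''(0) = 0`. [folklore] -/
theorem not_isLocalMin_traceSum {κ : Type*} (S : Finset κ) (A : κ → ℝ) (B : κ → Fin 3 → ℝ)
    (hA : ∀ k ∈ S, 64 / 49 < A k) (hB : ∀ k ∈ S, ∑ m, B k m ^ 2 = A k) (hS : S.Nonempty) :
    ¬ IsLocalMin (fun s : ℝ => ∑ k ∈ S, ∑ m : Fin 3,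
        (1 / 12 * ((A k + 2 * B k m * s + s ^ 2)⁻¹) ^ 6 - 1 / 6 * ((A k + 2 * B k m * s + s ^ 2)⁻¹) ^ 3)) 0 := by
  intro hmin
  -- the three functions
  set H : ℝ → ℝ := fun s => ∑ k ∈ S, ∑ m : Fin 3,
        (1 / 12 * ((A k + 2 * B k m * s + s ^ 2)⁻¹) ^ 6 - 1 / 6 * ((A k + 2 * B k m * s + s ^ 2)⁻¹) ^ 3) with hH
  set H1 : ℝ → ℝ := fun s => ∑ k ∈ S, ∑ m : Fin 3,
        ((-(1 / 2) * ((A k + 2 * B k m * s + s ^ 2)⁻¹) ^ 7 + 1 / 2 * ((A k + 2 * B k m * s + s ^ 2)⁻¹) ^ 4)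
          * (2 * B k m + 2 * s)) with hH1
  have hB2 : ∀ k ∈ S, ∀ m, B k m ^ 2 ≤ A k := fun k hk m => by
    rw [← hB k hk]
    exact Finset.single_le_sum (f := fun l => B k l ^ 2) (fun l _ => sq_nonneg (B k l)) (Finset.mem_univ m)
  have hq : ∀ k ∈ S, ∀ m, ∀ s : ℝ, |s| < 1 → A k + 2 * B k m * s + s ^ 2 ≠ 0 :=
    fun k hk m s hs => quad_ne_zero (hA k hk) (hB2 k hk m) hs
  -- first derivative on `(-1, 1)`
  have hHd : ∀ s : ℝ, |s| < 1 → HasDerivAt H (H1 s) s := fun s hs => by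
    rw [hH]
    simp only [hH1]
    exact HasDerivAt.fun_sum fun k hk => HasDerivAt.fun_sum fun m _ => hasDerivAt_Wq (hq k hk m s hs)
  have hev : deriv H =ᶠ[𝓝 0] H1 := by
    filter_upwards [Ioo_mem_nhds (show (-1 : ℝ) < 0 by norm_num) (show (0 : ℝ) < 1 by norm_num)] with s hs
    exact (hHd s (abs_lt.2 hs)).deriv
  -- second derivative at `0`
  have hval : ∀ k ∈ S, (∑ m : Fin 3,
      ((7 / 2 * ((A k + 2 * B k m * 0 + 0 ^ 2)⁻¹) ^ 8 - 2 * ((A k + 2 * B k m * 0 + 0 ^ 2)⁻¹) ^ 5)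
          * (2 * B k m + 2 * 0) * (2 * B k m + 2 * 0)
        + (-(1 / 2) * ((A k + 2 * B k m * 0 + 0 ^ 2)⁻¹) ^ 7 + 1 / 2 * ((A k + 2 * B k m * 0 + 0 ^ 2)⁻¹) ^ 4) * 2))
      = 11 * ((A k)⁻¹) ^ 7 - 5 * ((A k)⁻¹) ^ 4 := by
    intro k hk
    have hA0 : A k ≠ 0 := (by linarith [hA k hk] : (0 : ℝ) < A k).ne'
    have hAA : A k * (A k)⁻¹ = 1 := mul_inv_cancel₀ hA0
    have hB' := hB k hk
    simp only [Fin.sum_univ_three] at hB' ⊢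
    simp only [mul_zero, add_zero, zero_pow two_ne_zero]
    linear_combination (4 * (7 / 2 * ((A k)⁻¹) ^ 8 - 2 * ((A k)⁻¹) ^ 5)) * hB'
      + (14 * ((A k)⁻¹) ^ 7 - 8 * ((A k)⁻¹) ^ 4) * hAA
  have hH1d : HasDerivAt H1 (∑ k ∈ S, (11 * ((A k)⁻¹) ^ 7 - 5 * ((A k)⁻¹) ^ 4)) 0 := by
    rw [hH1]
    exact (HasDerivAt.fun_sum fun k hk => HasDerivAt.fun_sum fun m _ =>
      hasDerivAt_Wq1 (hq k hk m 0 (by norm_num))).congr_deriv (Finset.sum_congr rfl hval)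
  have hneg : (∑ k ∈ S, (11 * ((A k)⁻¹) ^ 7 - 5 * ((A k)⁻¹) ^ 4)) < 0 := by
    calc (∑ k ∈ S, (11 * ((A k)⁻¹) ^ 7 - 5 * ((A k)⁻¹) ^ 4)) < ∑ k ∈ S, (0 : ℝ) :=
          Finset.sum_lt_sum_of_nonempty hS fun k hk => trace_neg (hA k hk)
      _ = 0 := Finset.sum_const_zero
  have hd2 : deriv (deriv H) 0 = ∑ k ∈ S, (11 * ((A k)⁻¹) ^ 7 - 5 * ((A k)⁻¹) ^ 4) := by
    rw [hev.deriv_eq]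
    exact hH1d.deriv
  -- second-derivative test: `0` is also a local maximum, so `H` is locally constant
  have hd1 : deriv H 0 = 0 := hmin.deriv_eq_zero
  have hc : ContinuousAt H 0 := (hHd 0 (by norm_num)).continuousAt
  have hmax : IsLocalMax H 0 := isLocalMax_of_deriv_deriv_neg (by rw [hd2]; exact hneg) hd1 hc
  have heq : ∀ᶠ s in 𝓝 (0 : ℝ), H s = H 0 :=
    ((hmin : ∀ᶠ s in 𝓝 (0 : ℝ), H 0 ≤ H s).and (hmax : ∀ᶠ s in 𝓝 (0 : ℝ), H s ≤ H 0)).mono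
      fun s h => le_antisymm h.2 h.1
  have hd0 : ∀ᶠ s in 𝓝 (0 : ℝ), deriv H s = 0 :=
    heq.eventually_nhds.mono fun s hs => by
      rw [Filter.EventuallyEq.deriv_eq (hs : H =ᶠ[𝓝 s] fun _ => H 0)]
      exact deriv_const s (H 0)
  have : deriv (deriv H) 0 = 0 := by
    rw [Filter.EventuallyEq.deriv_eq (hd0 : deriv H =ᶠ[𝓝 (0 : ℝ)] fun _ => (0 : ℝ))]
    exact deriv_const (0 : ℝ) (0 : ℝ)
  rw [hd2] at this
  exact hneg.ne this

/-! ## §2 The relocation inequality, the coordinate displacement, and the trace contact radius -/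

/-- **Relocation inequality.** In a Lennard-Jones ground state, moving particle `i` to any point `z` avoiding the other
particles does not lower the energy: `𝓔ⁱ(x) = Σ_{k≠i} V_LJ(|x_i − x_k|) ≤ Σ_{k≠i} V_LJ(|z − x_k|)` (the pattern of
`siteEnergy_nonpos_of_isGroundState`). [folklore] -/
theorem siteEnergy_le_of_isGroundState {N : ℕ} {x : Fin N → EuclideanSpace ℝ (Fin 3)}
    (hx : IsGroundState lennardJones x) (i : Fin N) {z : EuclideanSpace ℝ (Fin 3)}
    (hz : ∀ k, k ≠ i → z ≠ x k) :
    siteEnergy lennardJones x i ≤ ∑ k ∈ Finset.univ.erase i, lennardJones (dist z (x k)) := by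
  have hinj : Function.Injective (Function.update x i z) := by
    intro a b hab
    by_cases ha : a = i <;> by_cases hb : b = i
    · exact ha.trans hb.symm
    · subst ha
      rw [Function.update_self, Function.update_of_ne hb] at hab
      exact absurd hab (hz b hb)
    · subst hb
      rw [Function.update_self, Function.update_of_ne ha] at hab
      exact absurd hab.symm (hz a ha)
    · rw [Function.update_of_ne ha, Function.update_of_ne hb] at hab
      exact hx.1 hab
  have hle : interactionEnergy lennardJones x ≤
      interactionEnergy lennardJones (Function.update x i z) := by
    rw [hx.2]
    exact groundStateEnergy_lennardJones_le hinj
  have hdiff := sum_siteEnergy_update_sub lennardJones x i z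
  have h2 := two_mul_interactionEnergy lennardJones x
  have h2' := two_mul_interactionEnergy lennardJones (Function.update x i z)
  linarith

/-- Squared distance after displacing `p` by `s` along the coordinate axis `m`:
`|p + s e_m − q|² = |p − q|² + 2 (p − q)_m s + s²`. [folklore] -/
theorem dist_sq_displace (p q : EuclideanSpace ℝ (Fin 3)) (m : Fin 3) (s : ℝ) :
    dist (p + s • EuclideanSpace.single m (1 : ℝ)) q ^ 2
      = dist p q ^ 2 + 2 * (p - q) m * s + s ^ 2 := by
  rw [dist_eq_norm, dist_eq_norm,
    show p + s • EuclideanSpace.single m (1 : ℝ) - q = (p - q) + s • EuclideanSpace.single m (1 : ℝ) by abel,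
    norm_add_sq_real, real_inner_smul_right, EuclideanSpace.inner_single_right, norm_smul,
    PiLp.norm_single, mul_pow]
  simp only [RCLike.conj_to_real, Real.norm_eq_abs, sq_abs, one_mul, abs_one, one_pow, mul_one]
  ring

/-- The displacement `x_i + s e_m`, `|s| < 1`, avoids every particle at distance `> 8/7` from `x_i`. [folklore] -/
theorem displace_ne {p q : EuclideanSpace ℝ (Fin 3)} (h : 8 / 7 < dist p q) (m : Fin 3) {s : ℝ} (hs : |s| < 1) :
    p + s • EuclideanSpace.single m (1 : ℝ) ≠ q := by
  intro he
  have h1 : dist p q ≤ dist p (p + s • EuclideanSpace.single m (1 : ℝ))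
      + dist (p + s • EuclideanSpace.single m (1 : ℝ)) q := dist_triangle _ _ _
  have h2 : dist p (p + s • EuclideanSpace.single m (1 : ℝ)) = |s| := by
    rw [dist_eq_norm, show p - (p + s • EuclideanSpace.single m (1 : ℝ))
        = -(s • EuclideanSpace.single m (1 : ℝ)) by abel,
      norm_neg, norm_smul, PiLp.norm_single, norm_one, mul_one, Real.norm_eq_abs]
  have h3 : dist (p + s • EuclideanSpace.single m (1 : ℝ)) q = 0 := dist_eq_zero.2 he
  linarith

/-- **TRACE CONTACT RADIUS of a Lennard-Jones ground state.** In a finite Lennard-Jones ground state in `ℝ³` with at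
least two particles, every particle has another particle within distance `8/7`: otherwise the trace of the Hessian of
its site energy, `Σ_{k≠i} (11 r_ik⁻¹⁴ − 5 r_ik⁻⁸)`, is negative (`r⁶ > 11/5` for `r > 8/7 > (11/5)^{1/6}`), so displacing
the particle along one of the three coordinate axes lowers the energy to second order — contradicting minimality among
configurations of distinct points (`not_isLocalMin_traceSum` + `siteEnergy_le_of_isGroundState`). [folklore] -/
theorem exists_dist_le_of_isGroundState {N : ℕ} {x : Fin N → EuclideanSpace ℝ (Fin 3)}
    (hx : IsGroundState lennardJones x) {i j : Fin N} (hji : j ≠ i) :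
    ∃ k, k ≠ i ∧ dist (x i) (x k) ≤ 8 / 7 := by
  by_contra hcon
  push Not at hcon
  set S : Finset (Fin N) := Finset.univ.erase i with hS
  have hmemS : ∀ {k : Fin N}, k ∈ S ↔ k ≠ i := by
    intro k
    simp [hS]
  obtain ⟨A, hA⟩ : ∃ A : Fin N → ℝ, A = fun k => dist (x i) (x k) ^ 2 := ⟨_, rfl⟩
  obtain ⟨B, hB⟩ : ∃ B : Fin N → Fin 3 → ℝ, B = fun k m => (x i - x k) m := ⟨_, rfl⟩
  obtain ⟨F, hF⟩ : ∃ F : Fin N → Fin 3 → ℝ → ℝ, F = fun k m s =>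
      1 / 12 * ((A k + 2 * B k m * s + s ^ 2)⁻¹) ^ 6 - 1 / 6 * ((A k + 2 * B k m * s + s ^ 2)⁻¹) ^ 3 :=
    ⟨_, rfl⟩
  have hA' : ∀ k ∈ S, 64 / 49 < A k := fun k hk => by
    have h := hcon k (hmemS.1 hk)
    have h0 : (0 : ℝ) ≤ 8 / 7 := by norm_num
    rw [hA]
    nlinarith [mul_le_mul h.le h.le h0 dist_nonneg]
  have hB' : ∀ k ∈ S, ∑ m, B k m ^ 2 = A k := fun k _ => by
    simp only [hA, hB, dist_eq_norm, EuclideanSpace.norm_sq_eq, Real.norm_eq_abs, sq_abs]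
  have hSne : S.Nonempty := ⟨j, hmemS.2 hji⟩
  -- the summands are the displaced pair energies
  have key : ∀ (s : ℝ) (m : Fin 3) (k : Fin N),
      lennardJones (dist (x i + s • EuclideanSpace.single m (1 : ℝ)) (x k)) = F k m s := by
    intro s m k
    rw [lennardJones_eq_sq, dist_sq_displace]
    simp only [hF, hA, hB]
  -- minimality: `s ↦ Σ_k Σ_m F k m s` has a local minimum at `0`
  have hloc : IsLocalMin (fun s => ∑ k ∈ S, ∑ m : Fin 3, F k m s) 0 := by
    show ∀ᶠ s in 𝓝 (0 : ℝ), (∑ k ∈ S, ∑ m : Fin 3, F k m 0) ≤ ∑ k ∈ S, ∑ m : Fin 3, F k m s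
    filter_upwards [Ioo_mem_nhds (show (-1 : ℝ) < 0 by norm_num) (show (0 : ℝ) < 1 by norm_num)] with s hs
    have hs' : |s| < 1 := abs_lt.2 hs
    have hm : ∀ m : Fin 3, ∑ k ∈ S, F k m 0 ≤ ∑ k ∈ S, F k m s := by
      intro m
      have h0 : ∑ k ∈ S, F k m 0 = siteEnergy lennardJones x i := by
        rw [siteEnergy, ← hS]
        refine Finset.sum_congr rfl fun k _ => ?_
        rw [← key 0 m k, zero_smul, add_zero]
      have h1 : ∑ k ∈ S, F k m s
          = ∑ k ∈ S, lennardJones (dist (x i + s • EuclideanSpace.single m (1 : ℝ)) (x k)) :=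
        Finset.sum_congr rfl fun k _ => (key s m k).symm
      rw [h0, h1, hS]
      exact siteEnergy_le_of_isGroundState hx i fun k hk => displace_ne (hcon k hk) m hs'
    calc (∑ k ∈ S, ∑ m : Fin 3, F k m 0) = ∑ m : Fin 3, ∑ k ∈ S, F k m 0 := Finset.sum_comm
      _ ≤ ∑ m : Fin 3, ∑ k ∈ S, F k m s := Finset.sum_le_sum fun m _ => hm m
      _ = ∑ k ∈ S, ∑ m : Fin 3, F k m s := Finset.sum_comm
  have hnot := not_isLocalMin_traceSum S A B hA' hB' hSne
  rw [hF] at hloc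
  exact hnot hloc

end Summit.AtomisticToContinuum.Crystallization.Theorems.ContactSaturationLadderTraceContact
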